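/-
Copyright (c) 2026 the pub-hodgecm-mathlib formalisation cell (harness21).  Prover seat hodgecm-mathlib-K2E4-p13 (g0),
Track B «K2-LIT» ∕ h413, ENGINE E4 unit U6 `ArchLimitConstant` — brick G2 «Δ″ along the H-WALL step curve, mixed other-place data» of the G′ package of socket #9
`sig_K2E4ExplicitArchSingularTransfer` (K2E4-p11 sub-cut 2026-09-03T21:27:20Z; assembler K2E4-p09).  2026-09-03.
-/
import Literature.NumberTheory.Rogawski1990.ArchExplicitTransferFactorCayleyTorus   -- ★ LH3-p04 (g2) (Δ-def-explicit): `exists_archExplicitDelta_cayleyTorus_relabel_eq_prod` (`Δ″ = K_ρ · Π_w Laurent`), the Cayley family `γH`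
import HarnessLib

/-!
# K2 · E4 · U6, brick G2 `ArchWallDeltaFactor`: along the `H`-WALL step curve at one place, with MIXED data at the other places, the pinned factor is `T′.Δ = K_ρ · σ(ψ)` with `σ` smooth, EVEN and
# `σ(0) ≠ 0`, `K_ρ ≠ 0` an explicit sign (Rogawski 1990 §8.2 p. 119 «`τ(γ)|A₁A₂|` … is smooth», §4.9 p. 55; Langlands–Shelstad 1987 §2)

Cell `pub/hodgecm-mathlib` (D-0151), HCML Track B, crux H413 = `stmt-HodgeConjecture-24833`; socket #9 `sig_K2E4ExplicitArchSingularTransfer` of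
`Cruxes/H413/Lines/K2_E4_SingularTransferKappaSignSigsArchLimitConstant.lean` (the VALUE identity «`Φ^{st,sing}_∞(a)(γ₀ ⊗ 1) = cinf · aH(γ_H ⊗ 1)`, `cinf ≠ 0`», chair ruling R-13a);
the G′ package (K2E4-p09 spec 21:20:04Z: a state family `B(S, u)` with (reg)∕(step)∕(end)), sub-cut G1∕G2∕G3∕G4 (K2E4-p11 21:27:20Z).  THIS FILE = G2.

THE MATHEMATICS.  On the rational diagonal frame `G′_∞ = U(diagonal α)(L⁺ ⊗ ℝ)` (`α_i ≠ 0`, `c(α_i) = α_i`), with the archimedean factor on print's ray `T′.Δ = cT · Δ″_∞(·, μ, ·)` (`cT ≠ 0`,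
`μ|_{𝕀_{L⁺}} = ω_{L∕L⁺}`): ★ (Δ-def-explicit) `exists_archExplicitDelta_cayleyTorus_relabel_eq_prod` reads `Δ″` on the Cayley family `γ_H(z)` (2-block angles `z_{v,0}, z_{v,2}`, `U(Φ₁)`-angle
`z_{v,1}`) against every relabelled partner `t(z ∘ ρ)` as `K_ρ · Π_v [−(z_{v,0} z_{v,2})^{k_v} (z_{v,1} − z_{v,0})(z_{v,1} − z_{v,2}) ∕ z_{v,1}]`, `K_ρ = Π_v sgn(re σ_v α_{ρ_v⁻¹ 1})·η_v`.  The
`H`-WALL STEP CURVE at the place `w` of the descent (★ `ArchEndoscopicCentralDescentValue`, ★ `K2E4ArchSingularKernelPlaceInduction`) is the datum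
`Z(ψ)_v = (ũ′_{v,0}, δ_v, ũ′_{v,1})`, `ũ′ = ũ[w ↦ (ζ_w e^{iψ}, ζ_w e^{−iψ})]`, the other places carrying ARBITRARY 2-block data `ũ_v` (regular, or already AT the wall `(ζ_v, ζ_v)`) subject only
to `ũ_{v,i} ≠ δ_v` (`D_{G∕H} ≠ 0`).  Along it `z_{w,0} z_{w,2} = ζ_w²` is `ψ`-FREE and `q_w(ψ) = (δ_w − ζ_w e^{iψ})(δ_w − ζ_w e^{−iψ})` is EVEN with `q_w(0) = (δ_w − ζ_w)² ≠ 0`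
(`ζ_w ≠ δ_w`: the semiregular point `γ_H ⊗ 1 = ((e₁•1₂) ⊗ 1, e₂ ⊗ 1)` has `σ_w e₁ ≠ σ_w e₂`); so `T′.Δ(γ_H(Z(ψ)), t(Z(ψ) ∘ ρ)) = K_ρ · σ(ψ)` with
`σ(ψ) = C · q_w(ψ)`, `C = cT · [−(ζ_w²)^{k_w} ∕ δ_w] · Π_{v ≠ w} [−(ũ_{v,0} ũ_{v,1})^{k_v} (δ_v − ũ_{v,0})(δ_v − ũ_{v,1}) ∕ δ_v] ≠ 0`: `σ` is `C^∞`, even, `σ(0) ≠ 0` — the flat factor that ★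
`K2E4ArchSingularKernelWallStepLemmas.tendsto_deriv_mul_of_tendsto_deriv_factor_zero` (K2E4-p11) carries through the `G′`-step, and `K_ρ ≠ 0` (every `re σ_v α_i ≠ 0`, `η_v = ±1`).

* §1 `contDiff_wallFactor`, `wallFactor_neg`, `wallFactor_zero_ne_zero` — the one-place function `q(ψ) = (δ − ζ e^{iψ})(δ − ζ e^{−iψ})` on `ℂ`.
* §2 `kappaSignProduct_ne_zero` — `K_ρ ≠ 0` for hermitian non-degenerate diagonal `α` (★ `archMajoritySign_ne_zero`, ★ `im_embedding_eq_zero_of_complexConj_eq`).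
* §3 **`archTransferFactor_cayleyTorus_relabel_eq_sign_mul`** — THE PRODUCT FORM on the ray: with the exponents `k` of ★ (Δ-def-explicit), for every datum `z` and every `ρ`,
  `T′.Δ (γH z) (t(z ∘ ρ)) = K_ρ · (cT · Π_v Laurent_v(z_v))`; **`exists_wallDeltaFactor`** — THE PACKAGE in K2E4-p11's binder shape:
  `∃ K σ, ContDiff ℝ 1 σ ∧ (∀ ψ, σ (−ψ) = σ ψ) ∧ σ 0 ≠ 0 ∧ (∀ ρ, K ρ ≠ 0) ∧ ∀ ψ ρ, T′.Δ (γH (Z ψ)) (archDiagTorus L 3 α (fun v => Z ψ v ∘ ρ v)) = K ρ * σ ψ`.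
The family `γH` is the abstract Cayley family of ★ (W1-cont)∕(Δ-def-explicit) (equality binder `hγH`, tokens VERBATIM); the assembler's `γH[u] = (Ψ_{Q₂}⁻¹ t(u), e₁⁻¹(diag δ))` is the same point by
★ `archCongrOfEq_quasiSplitFrameTwo_symm_archDiagTorus` (as in ★ (β)).
HONEST LABEL: HC_CM is proved only modulo the 7 printed citations (2 remaining named inputs: hLiu418 = stmt-HodgeConjecture-24832, h413 = stmt-HodgeConjecture-24833) until rung 0 closes; this
file is algebra ∕ one-variable calculus over ★ (Δ-def-explicit) and pays no socket by itself.

## References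
* [Rogawski1990] J. D. Rogawski, *Automorphic Representations of Unitary Groups in Three Variables*, Ann. of Math. Stud. 123 (1990), §8.2 Prop. 8.2.1 proof p. 119 (`τ(γ)|A₁A₂|` explicit and
  smooth in `ψ`), §4.9 p. 55 (`τ`, `D_{G∕H}`), §14.6 p. 242 (`κ = ±1`).
* [LanglandsShelstad1987] R. P. Langlands, D. Shelstad, *On the definition of transfer factors*, Math. Ann. 278 (1987), §2.
-/

set_option autoImplicit false

noncomputable section

open NumberField NumberField.InfinitePlace Topology Filter Set Function Complex
open scoped MatrixGroups ContDiff Classical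

namespace Summit.HodgeConjecture.HodgeConjecture.Cruxes.H413.K2E4ArchWallDeltaFactor

open Literature.NumberTheory.Rogawski1990 Literature.NumberTheory.Automorphic Literature.NumberTheory.GaloisRepresentations

/-! ## §1 The one-place wall factor `q(ψ) = (δ − ζ e^{iψ})(δ − ζ e^{−iψ})` -/

/-- The `U(Φ₁)`-vs-2-block discriminant along the `H`-wall step curve is smooth in the angle: `ψ ↦ (δ − ζ e^{iψ})(δ − ζ e^{−iψ})` is `C^∞` (Rogawski p. 119: «This is smooth»).
[cite: Rogawski1990, §8.2 p. 119] -/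
theorem contDiff_wallFactor (ζ δ : ℂ) {n : WithTop ℕ∞} :
    ContDiff ℝ n (fun ψ : ℝ => (δ - ζ * Complex.exp ((ψ : ℂ) * I)) * (δ - ζ * Complex.exp (((-ψ : ℝ) : ℂ) * I))) := by
  have h1 : ContDiff ℝ n (fun ψ : ℝ => Complex.exp ((ψ : ℂ) * I)) :=
    Complex.contDiff_exp.comp (Complex.ofRealCLM.contDiff.mul contDiff_const)
  have h2 : ContDiff ℝ n (fun ψ : ℝ => Complex.exp (((-ψ : ℝ) : ℂ) * I)) :=
    Complex.contDiff_exp.comp ((Complex.ofRealCLM.contDiff.comp contDiff_neg).mul contDiff_const)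
  exact (contDiff_const.sub (contDiff_const.mul h1)).mul (contDiff_const.sub (contDiff_const.mul h2))

/-- The wall factor is EVEN in the angle (the two 2-block eigenvalues `ζ e^{±iψ}` are exchanged by `ψ ↦ −ψ`). [cite: Rogawski1990, §8.2 p. 119] -/
theorem wallFactor_neg (ζ δ : ℂ) (ψ : ℝ) :
    (δ - ζ * Complex.exp (((-ψ : ℝ) : ℂ) * I)) * (δ - ζ * Complex.exp (((-(-ψ) : ℝ) : ℂ) * I)) =
      (δ - ζ * Complex.exp ((ψ : ℂ) * I)) * (δ - ζ * Complex.exp (((-ψ : ℝ) : ℂ) * I)) := by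
  rw [neg_neg, mul_comm]

/-- AT the wall the factor is `(δ − ζ)² ≠ 0` as soon as `ζ ≠ δ` (the semiregular guard `σ_w e₁ ≠ σ_w e₂`: `D_{G∕H,∞} ≠ 0` at `γ_H ⊗ 1`). [cite: Rogawski1990, §8.2 p. 119; §4.9 p. 55] -/
theorem wallFactor_zero_ne_zero {ζ δ : ℂ} (h : ζ ≠ δ) :
    (δ - ζ * Complex.exp (((0 : ℝ) : ℂ) * I)) * (δ - ζ * Complex.exp (((-(0 : ℝ) : ℝ) : ℂ) * I)) ≠ 0 := by
  simp only [neg_zero, Complex.ofReal_zero, zero_mul, Complex.exp_zero, mul_one]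
  exact mul_ne_zero (sub_ne_zero.2 (Ne.symm h)) (sub_ne_zero.2 (Ne.symm h))

/-! ## §2 The κ-sign `K_ρ` of a relabelled partner is non-zero -/

/-- **`K_ρ = Π_v sgn(re σ_v α_{ρ_v⁻¹ 1}) · η_v ≠ 0`** for a hermitian non-degenerate diagonal frame (`α_i ≠ 0`, `c(α_i) = α_i` ⇒ `σ_v α_i ∈ ℝ^×`; `η_v = ±1` ★ `archMajoritySign_ne_zero`).
[cite: Rogawski1990, §14.6 p. 242] [cite: LanglandsShelstad1987, §2] -/
theorem kappaSignProduct_ne_zero (L : Type) [Field L] [NumberField L] [IsCMField L] (α : Fin 3 → L)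
    (hα : ∀ i, α i ≠ 0) (hherm : ∀ i, (IsCMField.complexConj L (α i) : L) = α i)
    (ρ : {w : InfinitePlace L // IsComplex w} → Equiv.Perm (Fin 3)) :
    ((∏ w : {w : InfinitePlace L // IsComplex w}, ((SignType.sign ((w.1.embedding (α ((ρ w).symm 1))).re) : ℤ) * archMajoritySign L (Matrix.diagonal α) w) : ℤ) : ℂ) ≠ 0 := by
  rw [Int.cast_ne_zero]
  refine Finset.prod_ne_zero_iff.2 fun w _ => mul_ne_zero ?_ (archMajoritySign_ne_zero L (Matrix.diagonal α) w)
  have hre : (w.1.embedding (α ((ρ w).symm 1))).re ≠ 0 := by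
    intro h0
    have him : (w.1.embedding (α ((ρ w).symm 1))).im = 0 := UnitaryGroup.im_embedding_eq_zero_of_complexConj_eq L w (hherm _)
    have hz : w.1.embedding (α ((ρ w).symm 1)) = 0 := Complex.ext h0 him
    exact hα _ (w.1.embedding.injective (by rw [hz, map_zero]))
  intro h
  rcases lt_trichotomy (w.1.embedding (α ((ρ w).symm 1))).re 0 with hlt | heq | hgt
  · rw [sign_neg hlt] at h; exact absurd h (by decide)
  · exact hre heq
  · rw [sign_pos hgt] at h; exact absurd h (by decide)

/-! ## §3 `T′.Δ` along the `H`-wall step curve with mixed other-place data -/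

section WallCurve

variable (L : Type) [Field L] [NumberField L] [IsCMField L] (α : Fin 3 → L)
  (γH : ({w : InfinitePlace L // IsComplex w} → Fin 3 → Circle) →
    ↥(UnitaryGroup.arch (↥(maximalRealSubfield L)) L (IsCMField.complexConj L) 2
        (Matrix.of fun i j : Fin 2 => if i.val + j.val + 1 = 2 then (1 : L) else 0)) ×
      ↥(UnitaryGroup.arch (↥(maximalRealSubfield L)) L (IsCMField.complexConj L) 1
        (Matrix.of fun i j : Fin 1 => if i.val + j.val + 1 = 1 then (1 : L) else 0)))
  (hγH : γH = fun z =>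
    ((UnitaryGroup.archPiEquivCM 2 L (Matrix.of fun i j : Fin 2 => if i.val + j.val + 1 = 2 then (1 : L) else 0)).symm fun w =>
        ⟨Matrix.GeneralLinearGroup.mkOfDetNeZero !![(1 : ℂ), 1; 1, -1] UnitaryGroup.det_cayleyTwo_ne_zero *
            UnitaryGroup.circleDiagonal 2 ![z w 0, z w 2] *
          (Matrix.GeneralLinearGroup.mkOfDetNeZero !![(1 : ℂ), 1; 1, -1] UnitaryGroup.det_cayleyTwo_ne_zero)⁻¹,
          UnitaryGroup.cayley_conj_circleDiagonal_mem_archLocal L w _⟩,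
      (UnitaryGroup.archPiEquivCM 1 L (Matrix.of fun i j : Fin 1 => if i.val + j.val + 1 = 1 then (1 : L) else 0)).symm fun w =>
        ⟨UnitaryGroup.circleDiagonal 1 ![z w 1], UnitaryGroup.circleDiagonal_mem_archLocal_antidiagOne L w _⟩))
  (μ : HeckeCharacter L)
  (hμω : ∀ x : ideleGroup ↥(maximalRealSubfield L), μ (AdeleRing.ideleBaseChange (↥(maximalRealSubfield L)) L x) = quadraticHeckeCharCM L x)
  (T' : ArchTransferFactor L (Matrix.diagonal α)) (cT : ℂ)
  (hT : ∀ a b, T'.Δ a b = cT * archExplicitDelta L (Matrix.diagonal α) a μ b)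
  -- the step: the moving place `w`, the 2-block CENTRE angles `ζ`, the frozen `U(Φ₁)`-angles `δ`, the other places' 2-block data `ũ`
  (w : {w : InfinitePlace L // IsComplex w}) (ζ δ : {w : InfinitePlace L // IsComplex w} → Circle) (ũ : {w : InfinitePlace L // IsComplex w} → Fin 2 → Circle)

include hT in
/-- **`T′.Δ` ON THE CAYLEY FAMILY, PRODUCT FORM** (★ (Δ-def-explicit) on the ray): with the exponents `k` of ★ `exists_archExplicitDelta_cayleyTorus_relabel_eq_prod` (`hk`), for every datum `z`
and every relabelling `ρ`, `T′.Δ (γH z) (t(z ∘ ρ)) = K_ρ · (cT · Π_v [−(z_{v,0} z_{v,2})^{k_v} (z_{v,1} − z_{v,0})(z_{v,1} − z_{v,2}) ∕ z_{v,1}])` — the sign `K_ρ` is `ψ`∕datum-free, the rest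
is a product of per-place Laurent monomials. [cite: Rogawski1990, §8.2 p. 119; §4.9 p. 55; §14.6 p. 242] -/
theorem archTransferFactor_cayleyTorus_relabel_eq_sign_mul (k : {w : InfinitePlace L // IsComplex w} → ℤ)
    (hk : ∀ (z : {w : InfinitePlace L // IsComplex w} → Fin 3 → Circle) (ρ : {w : InfinitePlace L // IsComplex w} → Equiv.Perm (Fin 3)),
      archExplicitDelta L (Matrix.diagonal α) (γH z) μ (UnitaryGroup.archDiagTorus L 3 α fun v => z v ∘ ρ v) =
        ((∏ v : {w : InfinitePlace L // IsComplex w}, ((SignType.sign ((v.1.embedding (α ((ρ v).symm 1))).re) : ℤ) * archMajoritySign L (Matrix.diagonal α) v) : ℤ) : ℂ) *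
          ∏ v : {w : InfinitePlace L // IsComplex w},
            -((((z v 0 : ℂ) * (z v 2 : ℂ)) ^ (k v)) * (((z v 1 : ℂ) - (z v 0 : ℂ)) * ((z v 1 : ℂ) - (z v 2 : ℂ))) / (z v 1 : ℂ)))
    (z : {w : InfinitePlace L // IsComplex w} → Fin 3 → Circle) (ρ : {w : InfinitePlace L // IsComplex w} → Equiv.Perm (Fin 3)) :
    T'.Δ (γH z) (UnitaryGroup.archDiagTorus L 3 α fun v => z v ∘ ρ v) =
      ((∏ v : {w : InfinitePlace L // IsComplex w}, ((SignType.sign ((v.1.embedding (α ((ρ v).symm 1))).re) : ℤ) * archMajoritySign L (Matrix.diagonal α) v) : ℤ) : ℂ) *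
        (cT * ∏ v : {w : InfinitePlace L // IsComplex w},
            -((((z v 0 : ℂ) * (z v 2 : ℂ)) ^ (k v)) * (((z v 1 : ℂ) - (z v 0 : ℂ)) * ((z v 1 : ℂ) - (z v 2 : ℂ))) / (z v 1 : ℂ))) := by
  rw [hT, hk, mul_left_comm]

omit [NumberField L] [IsCMField L] in
/-- The per-place Laurent factor of the step datum AT THE MOVING PLACE `w` is `−(ζ_w²)^{k} · q_w(ψ) ∕ δ_w` (the updated 2-block angles are `ζ_w e^{±iψ}`, their product is `ζ_w²`).
[cite: Rogawski1990, §8.2 p. 119] -/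
private theorem lau_update_self (kw : ℤ) (ψ : ℝ) :
    -(((((Function.update ũ w ![ζ w * Circle.exp ψ, ζ w * Circle.exp (-ψ)]) w 0 : Circle) : ℂ) *
          (((Function.update ũ w ![ζ w * Circle.exp ψ, ζ w * Circle.exp (-ψ)]) w 1 : Circle) : ℂ)) ^ kw *
        ((((δ w : ℂ) - (((Function.update ũ w ![ζ w * Circle.exp ψ, ζ w * Circle.exp (-ψ)]) w 0 : Circle) : ℂ)) *
          ((δ w : ℂ) - (((Function.update ũ w ![ζ w * Circle.exp ψ, ζ w * Circle.exp (-ψ)]) w 1 : Circle) : ℂ)))) / (δ w : ℂ)) =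
      (-(((ζ w : ℂ) * (ζ w : ℂ)) ^ kw) / (δ w : ℂ)) *
        (((δ w : ℂ) - (ζ w : ℂ) * Complex.exp ((ψ : ℂ) * I)) * ((δ w : ℂ) - (ζ w : ℂ) * Complex.exp (((-ψ : ℝ) : ℂ) * I))) := by
  simp only [Function.update_self, Matrix.cons_val_zero, Matrix.cons_val_one, Circle.coe_mul, Circle.coe_exp]
  have he : Complex.exp ((ψ : ℂ) * I) * Complex.exp (((-ψ : ℝ) : ℂ) * I) = 1 := by
    rw [← Complex.exp_add, Complex.ofReal_neg, neg_mul, add_neg_cancel, Complex.exp_zero]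
  have hζζ : (ζ w : ℂ) * Complex.exp ((ψ : ℂ) * I) * ((ζ w : ℂ) * Complex.exp (((-ψ : ℝ) : ℂ) * I)) = (ζ w : ℂ) * (ζ w : ℂ) := by
    calc (ζ w : ℂ) * Complex.exp ((ψ : ℂ) * I) * ((ζ w : ℂ) * Complex.exp (((-ψ : ℝ) : ℂ) * I))
        = (ζ w : ℂ) * (ζ w : ℂ) * (Complex.exp ((ψ : ℂ) * I) * Complex.exp (((-ψ : ℝ) : ℂ) * I)) := by ring
      _ = (ζ w : ℂ) * (ζ w : ℂ) := by rw [he, mul_one]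
  rw [hζζ]
  ring

omit [NumberField L] [IsCMField L] in
/-- … and AT ANOTHER PLACE `v ≠ w` it is the `ψ`-free `−(ũ_{v,0} ũ_{v,1})^{k} (δ_v − ũ_{v,0})(δ_v − ũ_{v,1}) ∕ δ_v`. [cite: Rogawski1990, §8.2 p. 119] -/
private theorem lau_update_of_ne (kv : ℤ) (ψ : ℝ) {v : {w : InfinitePlace L // IsComplex w}} (hv : v ≠ w) :
    -(((((Function.update ũ w ![ζ w * Circle.exp ψ, ζ w * Circle.exp (-ψ)]) v 0 : Circle) : ℂ) *
          (((Function.update ũ w ![ζ w * Circle.exp ψ, ζ w * Circle.exp (-ψ)]) v 1 : Circle) : ℂ)) ^ kv *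
        ((((δ v : ℂ) - (((Function.update ũ w ![ζ w * Circle.exp ψ, ζ w * Circle.exp (-ψ)]) v 0 : Circle) : ℂ)) *
          ((δ v : ℂ) - (((Function.update ũ w ![ζ w * Circle.exp ψ, ζ w * Circle.exp (-ψ)]) v 1 : Circle) : ℂ)))) / (δ v : ℂ)) =
      -((((ũ v 0 : ℂ) * (ũ v 1 : ℂ)) ^ kv) * (((δ v : ℂ) - (ũ v 0 : ℂ)) * ((δ v : ℂ) - (ũ v 1 : ℂ))) / (δ v : ℂ)) := by
  simp only [Function.update_of_ne hv]

include hγH hT hμω in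
/-- **BRICK G2 — THE PACKAGE** (K2E4-p11's binder shape, 2026-09-03T21:27:20Z): at the place `w`, with the 2-block centre angles `ζ`, frozen `U(Φ₁)`-angles `δ` (`ζ_w ≠ δ_w`) and other-place
data `ũ` off the `G∕H`-walls (`ũ_{v,i} ≠ δ_v` for `v ≠ w`), there are a SIGN `K : (W → S₃) → ℂ` (all `≠ 0`; explicitly `K_ρ = Π_v sgn(re σ_v α_{ρ_v⁻¹ 1})·η_v`) and ONE function `σ : ℝ → ℂ`,
`C¹` (indeed `C^∞`), EVEN, with `σ 0 ≠ 0`, such that along the `H`-wall step curve — the 3-slot datum `Z(ψ)_v = (ũ′_{v,0}, δ_v, ũ′_{v,1})`, `ũ′ = ũ[w ↦ (ζ_w e^{iψ}, ζ_w e^{−iψ})]` —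
`T′.Δ (γH (Z ψ)) (t(Z ψ ∘ ρ)) = K ρ · σ ψ` for every `ψ` and every relabelling `ρ`.  Here `σ ψ = cT · Π_v [−(Z(ψ)_{v,0} Z(ψ)_{v,2})^{k_v}(δ_v − Z(ψ)_{v,0})(δ_v − Z(ψ)_{v,2}) ∕ δ_v]`
whose `w`-factor is `−(ζ_w²)^{k_w}∕δ_w · (δ_w − ζ_w e^{iψ})(δ_w − ζ_w e^{−iψ})` (`lau_update_self`) and whose other factors are `ψ`-free (`lau_update_of_ne`).  Consumed by G3 (the `G′`-step law:
`σ` is the flat factor of ★ `tendsto_deriv_mul_of_tendsto_deriv_factor_zero`) and by the assembler's (end) (`σ 0` at all-wall data is the `S(wall)` of `λ`).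
[cite: Rogawski1990, §8.2 p. 119; §4.9 p. 55; §14.6 p. 242] [cite: LanglandsShelstad1987, §2] -/
theorem exists_wallDeltaFactor (hα : ∀ i, α i ≠ 0) (hherm : ∀ i, (IsCMField.complexConj L (α i) : L) = α i) (hcT : cT ≠ 0)
    (hζδ : ζ w ≠ δ w) (hũ : ∀ v, v ≠ w → ũ v 0 ≠ δ v ∧ ũ v 1 ≠ δ v) :
    ∃ (K : ({w : InfinitePlace L // IsComplex w} → Equiv.Perm (Fin 3)) → ℂ) (σ : ℝ → ℂ),
      ContDiff ℝ 1 σ ∧ (∀ ψ, σ (-ψ) = σ ψ) ∧ σ 0 ≠ 0 ∧ (∀ ρ, K ρ ≠ 0) ∧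
      ∀ (ψ : ℝ) (ρ : {w : InfinitePlace L // IsComplex w} → Equiv.Perm (Fin 3)),
        T'.Δ (γH fun v => ![(Function.update ũ w ![ζ w * Circle.exp ψ, ζ w * Circle.exp (-ψ)]) v 0, δ v, (Function.update ũ w ![ζ w * Circle.exp ψ, ζ w * Circle.exp (-ψ)]) v 1])
            (UnitaryGroup.archDiagTorus L 3 α fun v =>
              (![(Function.update ũ w ![ζ w * Circle.exp ψ, ζ w * Circle.exp (-ψ)]) v 0, δ v, (Function.update ũ w ![ζ w * Circle.exp ψ, ζ w * Circle.exp (-ψ)]) v 1] : Fin 3 → Circle) ∘ ρ v) =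
          K ρ * σ ψ := by
  obtain ⟨k, hk⟩ := exists_archExplicitDelta_cayleyTorus_relabel_eq_prod L α γH hγH μ hμω
  -- the per-place Laurent factor along the step datum, as a function of `ψ` (slots read: `0 ↦ ũ′_{v,0}`, `1 ↦ δ_v`, `2 ↦ ũ′_{v,1}`)
  set F : {w : InfinitePlace L // IsComplex w} → ℝ → ℂ := fun v ψ =>
    -(((((Function.update ũ w ![ζ w * Circle.exp ψ, ζ w * Circle.exp (-ψ)]) v 0 : Circle) : ℂ) *
          (((Function.update ũ w ![ζ w * Circle.exp ψ, ζ w * Circle.exp (-ψ)]) v 1 : Circle) : ℂ)) ^ (k v) *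
        ((((δ v : ℂ) - (((Function.update ũ w ![ζ w * Circle.exp ψ, ζ w * Circle.exp (-ψ)]) v 0 : Circle) : ℂ)) *
          ((δ v : ℂ) - (((Function.update ũ w ![ζ w * Circle.exp ψ, ζ w * Circle.exp (-ψ)]) v 1 : Circle) : ℂ)))) / (δ v : ℂ)) with hF
  have hFw : ∀ ψ, F w ψ = (-(((ζ w : ℂ) * (ζ w : ℂ)) ^ (k w)) / (δ w : ℂ)) *
      (((δ w : ℂ) - (ζ w : ℂ) * Complex.exp ((ψ : ℂ) * I)) * ((δ w : ℂ) - (ζ w : ℂ) * Complex.exp (((-ψ : ℝ) : ℂ) * I))) :=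
    fun ψ => lau_update_self L w ζ δ ũ (k w) ψ
  have hFv : ∀ v, v ≠ w → ∀ ψ, F v ψ = -((((ũ v 0 : ℂ) * (ũ v 1 : ℂ)) ^ (k v)) * (((δ v : ℂ) - (ũ v 0 : ℂ)) * ((δ v : ℂ) - (ũ v 1 : ℂ))) / (δ v : ℂ)) :=
    fun v hv ψ => lau_update_of_ne L w ζ δ ũ (k v) ψ hv
  refine ⟨fun ρ => ((∏ v : {w : InfinitePlace L // IsComplex w}, ((SignType.sign ((v.1.embedding (α ((ρ v).symm 1))).re) : ℤ) * archMajoritySign L (Matrix.diagonal α) v) : ℤ) : ℂ),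
    fun ψ => cT * ∏ v : {w : InfinitePlace L // IsComplex w}, F v ψ, ?_, ?_, ?_, kappaSignProduct_ne_zero L α hα hherm, fun ψ ρ => ?_⟩
  · -- `C¹`: the `w`-factor is the smooth wall factor, the others are constants
    refine contDiff_const.mul (contDiff_prod fun v _ => ?_)
    by_cases hv : v = w
    · subst hv
      rw [show F v = fun ψ : ℝ => (-(((ζ v : ℂ) * (ζ v : ℂ)) ^ (k v)) / (δ v : ℂ)) *
          (((δ v : ℂ) - (ζ v : ℂ) * Complex.exp ((ψ : ℂ) * I)) * ((δ v : ℂ) - (ζ v : ℂ) * Complex.exp (((-ψ : ℝ) : ℂ) * I))) from funext (hFw)]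
      exact contDiff_const.mul (contDiff_wallFactor (ζ v : ℂ) (δ v : ℂ))
    · rw [show F v = fun _ => -((((ũ v 0 : ℂ) * (ũ v 1 : ℂ)) ^ (k v)) * (((δ v : ℂ) - (ũ v 0 : ℂ)) * ((δ v : ℂ) - (ũ v 1 : ℂ))) / (δ v : ℂ)) from funext (hFv v hv)]
      exact contDiff_const
  · -- EVEN
    intro ψ
    refine congrArg (fun x : ℂ => cT * x) (Finset.prod_congr rfl fun v _ => ?_)
    by_cases hv : v = w
    · subst hv
      rw [hFw, hFw, wallFactor_neg]
    · rw [hFv v hv, hFv v hv]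
  · -- `σ 0 ≠ 0`
    refine mul_ne_zero hcT (Finset.prod_ne_zero_iff.2 fun v _ => ?_)
    by_cases hv : v = w
    · subst hv
      rw [hFw]
      exact mul_ne_zero (div_ne_zero (neg_ne_zero.2 (zpow_ne_zero _ (mul_ne_zero (Circle.coe_ne_zero _) (Circle.coe_ne_zero _)))) (Circle.coe_ne_zero _))
        (wallFactor_zero_ne_zero fun h => hζδ (Circle.ext h))
    · rw [hFv v hv]
      refine neg_ne_zero.2 (div_ne_zero (mul_ne_zero (zpow_ne_zero _ (mul_ne_zero (Circle.coe_ne_zero _) (Circle.coe_ne_zero _))) (mul_ne_zero ?_ ?_)) (Circle.coe_ne_zero _))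
      · exact sub_ne_zero.2 fun h => (hũ v hv).1 (Circle.ext h).symm
      · exact sub_ne_zero.2 fun h => (hũ v hv).2 (Circle.ext h).symm
  · -- the identity: ★ (Δ-def-explicit) at the step datum (slots `0, 1, 2` = `ũ′_{v,0}, δ_v, ũ′_{v,1}`)
    rw [archTransferFactor_cayleyTorus_relabel_eq_sign_mul L α γH μ T' cT hT k hk]
    simp only [hF, Matrix.cons_val_zero, Matrix.cons_val_one, Matrix.cons_val_two, Matrix.head_cons, Matrix.tail_cons]

end WallCurve

end Summit.HodgeConjecture.HodgeConjecture.Cruxes.H413.K2E4ArchWallDeltaFactor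

end
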